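import Summits.BirchSwinnertonDyer.Rank1Residual.Additive.X4RankZeroVisibleRefinedCertificateSharpSockets
import HarnessLib

/-!
# Record sockets with TWO paid places (`3` and one tame prime `ℓ`), prime-list form, over the (G)
# visibility ENDs — Kato's original upper half and the SHARP-Kato Tamagawa-defect-one upper half
# (cell `b2b-bsdres`, team n1011, row T-GSHARP FILE 3; seat p04 GEN 12; the three rank-3 `d1→T` rows of
# route planner 1's D44 road without a socket — r1 ROUTE-1 §51.2 (ii), n1011-p09 GEN 13's located gap)

HONEST FRAMING (cell `b2b-bsdres`, run/shared/lean/b2b/bsd-rank1-residual/, verbatim in every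
file): the goal of the cell is to DELETE the COMBINATION-SHAPED residual classes of the
Birch–Swinnerton-Dyer formula for ALL analytic-rank `≤ 1` elliptic curves over `ℚ` — "full BSD
formula for every rank `≤ 1` curve in class `C`" assembled STRICTLY from published theorems — so
that the rank-`≤ 1` remainder becomes exactly the CONSTRUCTION-SHAPED classes, which are TYPED
(missing-input `Prop`s), NOT attempted. This is not "finishing BSD". Team n1011 (N10 / N11, the
additive block X4 ∧ `p = 3`): research route on the CONSTRUCTION-SHAPED class X4; no claim beyond
the stated classes; nothing is booked; no mark / label / count is changed by this file. Theorems
only (no definition, no new named fact, no `sorry`). The sockets are CONDITIONAL on the displayed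
named facts of the (G) ENDs (`hKato` resp. `hKatoS`, `hCT`, `hGZK`, `hmod`, `hU`, `hU2`) and CLOSE
NOTHING by themselves: a per-row RECORD discharges `θ`, the integer models and discriminant supports,
`#E′(ℚ₃)[3] ≤ t`, `#E′(ℚ_ℓ)[3] ≤ u`, the Tamagawa binder and every disjunct of `hplaces` in the
kernel, and carries `hr`, `hq`/`hv`/`hev`, `hrank`, `D`/`hc` as EVIDENCE / displayed binders
(ruling of record for row shapes, n1011 lead R5-82 (d)).

## What

* `exists_paidPlaces_three_and` — plumbing: `T = {v₃, v_ℓ}` inside the places `S` over a list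
  `L ∋ 3, ℓ`, with the crude factor `(#E′(ℚ₃)[3]·#(ℤ₃/3ℤ₃))·(#E′(ℚ_ℓ)[3]·#(ℤ_ℓ/3ℤ_ℓ)) ≤ 3t·u < 3^k ≤
  3^{rank E′}` (`#(ℤ₃/3ℤ₃) = 3`, `#(ℤ_ℓ/3ℤ_ℓ) = 1` for `ℓ ≠ 3`: the Literature's
  `natCard_quot_adicCompletionIntegers_eq_one`);
* `X4RankZero.bsdp_three_of_congr_of_places₇_of_kato_of_primeList_paidThreeAndAt` — FILE 6's (G)
  socket with the second paid place (rows with `3 ∤ ∏ c_ℓ`, e.g. `405459b1`);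
* `X4RankZero.bsdp_three_of_congr_of_places₇_of_katoSharp_of_tamDefect_le_one_of_primeList_paidThreeAndAt`
  — FILE 2's defect-one socket with the second paid place (`260388a1`, `284445bc1`).
Binder order: FILE 6 / FILE 2 token for token, with `(ℓ) (hℓ) (hℓ3)` before `{t u k}`, `htorsℓ` after
`htors₃`, `hbudget : 3 * t * u < 3 ^ k`, `(hℓL : ℓ ∈ L)` after `h3L`, and `hplaces` taking the extra
premise `(primesEquiv w : ℕ) ≠ ℓ`.

References: [CremonaMazur2000] §3 and Table 1; [AgasheStein2002] Thm. 3.1; [Kato2004Asterisque]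
Thm. 14.5 (3), Prop. 14.16 (2); [SilvermanAEC2009] VII.5.1, X.4.14; [SilvermanATAEC1994] Ch. V;
cells/n1011/ROUTE-1.md §44, §51.2 (ii).
-/

set_option autoImplicit false

noncomputable section

open scoped Classical NumberField
open IsDedekindDomain NumberField WeierstrassCurve Rat.HeightOneSpectrum
  Literature.NumberTheory.EllipticCurves Literature.NumberTheory.EllipticCurves.ModularForms
  Literature.NumberTheory.EllipticCurves.Rank1Residual
  Literature.NumberTheory.EllipticCurves.Rank1Residual.Typed
  Literature.NumberTheory.GaloisRepresentations
  Summit.BirchSwinnertonDyer.Rank1Residual.GaloisImage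

namespace Summit.BirchSwinnertonDyer.Rank1Residual.Additive

/-! ### §1. Records plumbing: the places `3` and `ℓ` as the two PAID places -/

/-- **Two paid places `3` and `ℓ ≠ 3`** (records plumbing, no content): with `S` the places over a list
`L ∋ 3, ℓ`, the set `T = {v₃, v_ℓ}` satisfies `T ⊆ S`, every `w ∈ S ∖ T` has `ℓ_w ≠ 3` and `ℓ_w ≠ ℓ`,
and the crude factor on `T` is `(#E′(ℚ₃)[3]·3)·(#E′(ℚ_ℓ)[3]·1) ≤ 3t·u < 3^k ≤ 3^{rank E′}`
(`#(ℤ₃/3ℤ₃) = 3`: `GoodModelLine.natCard_adicCompletionIntegers_quot_span_eq`; `#(ℤ_ℓ/3ℤ_ℓ) = 1`: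
`natCard_quot_adicCompletionIntegers_eq_one`). [folklore] -/
theorem exists_paidPlaces_three_and (W' : WeierstrassCurve ℚ) (L : List ℕ) (h3L : 3 ∈ L)
    (ℓ : ℕ) (hℓ : ℓ.Prime) (hℓL : ℓ ∈ L) (hℓ3 : ℓ ≠ 3)
    {S : Finset (HeightOneSpectrum (𝓞 ℚ))}
    (hS : ∀ v : HeightOneSpectrum (𝓞 ℚ), v ∈ S ↔ (primesEquiv v : ℕ) ∈ L) {t u k : ℕ}
    (htors₃ : ∀ w : HeightOneSpectrum (𝓞 ℚ), (primesEquiv w : ℕ) = 3 →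
      Nat.card (nsmulAddMonoidHom 3 :
        (W'.baseChange (w.adicCompletion ℚ)).toAffine.Point →+ _).ker ≤ t)
    (htorsℓ : ∀ w : HeightOneSpectrum (𝓞 ℚ), (primesEquiv w : ℕ) = ℓ →
      Nat.card (nsmulAddMonoidHom 3 :
        (W'.baseChange (w.adicCompletion ℚ)).toAffine.Point →+ _).ker ≤ u)
    (hbudget : 3 * t * u < 3 ^ k) (hrank : k ≤ W'.mordellWeilRank) :
    ∃ T : Finset (HeightOneSpectrum (𝓞 ℚ)), T ⊆ S ∧
      (∏ w ∈ T, Nat.card (nsmulAddMonoidHom 3 :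
        (W'.baseChange (w.adicCompletion ℚ)).toAffine.Point →+ _).ker *
        Nat.card (w.adicCompletionIntegers ℚ ⧸
          Ideal.span {((3 : ℕ) : w.adicCompletionIntegers ℚ)})) < 3 ^ W'.mordellWeilRank ∧
      ∀ w ∈ S, w ∉ T → (primesEquiv w : ℕ) ≠ 3 ∧ (primesEquiv w : ℕ) ≠ ℓ := by
  haveI : Fact (Nat.Prime 3) := ⟨Nat.prime_three⟩
  set v₃ : HeightOneSpectrum (𝓞 ℚ) := (primesEquiv (R := 𝓞 ℚ)).symm ⟨3, Nat.prime_three⟩ with hv₃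
  set vℓ : HeightOneSpectrum (𝓞 ℚ) := (primesEquiv (R := 𝓞 ℚ)).symm ⟨ℓ, hℓ⟩ with hvℓ
  have hℓ₃ : (primesEquiv v₃ : ℕ) = 3 := by rw [hv₃, Equiv.apply_symm_apply]
  have hℓℓ : (primesEquiv vℓ : ℕ) = ℓ := by rw [hvℓ, Equiv.apply_symm_apply]
  have h3v₃ : ((3 : ℕ) : 𝓞 ℚ) ∈ v₃.asIdeal :=
    (natCast_mem_asIdeal_iff_eq_primesEquiv_symm v₃ Nat.prime_three).mpr hv₃
  have hne : v₃ ≠ vℓ := fun h ↦ hℓ3 (by rw [← hℓℓ, ← h, hℓ₃])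
  have h3vℓ : ((3 : ℕ) : 𝓞 ℚ) ∉ vℓ.asIdeal := fun h ↦
    hne ((natCast_mem_asIdeal_iff_eq_primesEquiv_symm vℓ Nat.prime_three).mp h).symm
  refine ⟨{v₃, vℓ}, ?_, ?_, fun w _ hw ↦ ⟨fun h3 ↦ hw ?_, fun hl ↦ hw ?_⟩⟩
  · rw [Finset.insert_subset_iff, Finset.singleton_subset_iff]
    exact ⟨(hS v₃).mpr (by rw [hℓ₃]; exact h3L), (hS vℓ).mpr (by rw [hℓℓ]; exact hℓL)⟩
  · rw [Finset.prod_pair hne, GoodModelLine.natCard_adicCompletionIntegers_quot_span_eq h3v₃,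
      natCard_quot_adicCompletionIntegers_eq_one h3vℓ, mul_one]
    calc _ ≤ t * 3 * u := Nat.mul_le_mul (Nat.mul_le_mul_right 3 (htors₃ v₃ hℓ₃)) (htorsℓ vℓ hℓℓ)
      _ < 3 ^ k := by rw [mul_comm t 3]; exact hbudget
      _ ≤ 3 ^ W'.mordellWeilRank := Nat.pow_le_pow_right (by norm_num) hrank
  · rw [Finset.mem_insert]
    exact Or.inl ((primesEquiv (R := 𝓞 ℚ)).injective (Subtype.ext (h3.trans hℓ₃.symm)))
  · rw [Finset.mem_insert, Finset.mem_singleton]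
    exact Or.inr ((primesEquiv (R := 𝓞 ℚ)).injective (Subtype.ext (hl.trans hℓℓ.symm)))

/-! ### §2. The two-paid-place record sockets -/

/-- **Record socket, potentially GOOD rows (Kato's ORIGINAL upper half, `3 ∤ ∏ c_ℓ`), TWO paid places:
`3` and one tame prime `ℓ ≠ 3`** (FILE 6's `…_of_kato_of_primeList_paidThree` with a second paid place:
`#E′(ℚ₃)[3] ≤ t`, `#E′(ℚ_ℓ)[3] ≤ u`, budget `3·t·u < 3^k`, `k ≤ rank E′(ℚ)` — the rank-3 `d1→T` rows of
route planner 1's D44 road, e.g. `405459b1 ← 450510a1` paid at `5`; every OTHER place over `L` of one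
of the seven kinds). [cite: CremonaMazur2000, §3 and Table 1] [cite: AgasheStein2002, Thm. 3.1]
[cite: Kato2004Asterisque, Thm. 14.5 (3) (p. 236)] [cite: SilvermanAEC2009, Thm. X.4.14] -/
theorem X4RankZero.bsdp_three_of_congr_of_places₇_of_kato_of_primeList_paidThreeAndAt
    (hKato : Kato2004.rankZero_padicValNat_sha_le_of_additive_potGood_of_imageContainsSL2)
    (hCT : exists_casselsTate_pairing (K := ℚ))
    (hGZK : rank_eq_analyticRank_of_analyticRank_le_one) (hmod : hasEntireLFunction_rat)
    (hU : Silverman1994_thmV53_tateUniformisation.{0})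
    (hU2 : Silverman1994_thmV53_corV54_tateUniformisation.{0})
    (W : WeierstrassCurve ℚ) [W.IsElliptic] [W.IsGloballyMinimal]
    (hr : W.analyticRank = 0) (hX : haveI : Fact (Nat.Prime 3) := ⟨Nat.prime_three⟩; ClassX4 W 3)
    (hpot : 0 ≤ padicValRat 3 W.j)
    (hsurj : ∀ n : ℕ, W.HasSurjectiveModNGaloisRep (3 ^ n : ℕ)) (htam : ¬ 3 ∣ W.tamagawaProduct)
    {N : ℕ} [NeZero N] (D : ModularParametrizationData W N) (hc : ¬ (3 : ℤ) ∣ D.maninConstant)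
    {q : ℚ} (hq : shaAn W = (q : ℂ)) (hv : padicValRat 3 q ≤ 2)
    (W' : WeierstrassCurve ℚ) [W'.IsElliptic]
    (θ : geomTorsion W' ((3 : ℕ) : ℤ) ≃+ geomTorsion W ((3 : ℕ) : ℤ))
    (hθ : ∀ (σ : Field.absoluteGaloisGroup ℚ) (P : geomTorsion W' ((3 : ℕ) : ℤ)),
      θ (σ • P) = σ • θ P)
    (ℓ : ℕ) (hℓ : ℓ.Prime) (hℓ3 : ℓ ≠ 3)
    {t u k : ℕ} (htors₃ : ∀ w : HeightOneSpectrum (𝓞 ℚ), (primesEquiv w : ℕ) = 3 →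
      Nat.card (nsmulAddMonoidHom 3 :
        (W'.baseChange (w.adicCompletion ℚ)).toAffine.Point →+ _).ker ≤ t)
    (htorsℓ : ∀ w : HeightOneSpectrum (𝓞 ℚ), (primesEquiv w : ℕ) = ℓ →
      Nat.card (nsmulAddMonoidHom 3 :
        (W'.baseChange (w.adicCompletion ℚ)).toAffine.Point →+ _).ker ≤ u)
    (hbudget : 3 * t * u < 3 ^ k) (hrank : k ≤ W'.mordellWeilRank)
    {E₀ F₀ : WeierstrassCurve ℤ} (hE : E₀.map (Int.castRingHom ℚ) = W)
    (hF : F₀.map (Int.castRingHom ℚ) = W') (L : List ℕ) (h3L : 3 ∈ L) (hℓL : ℓ ∈ L)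
    (hΔE : ∀ q : ℕ, q.Prime → (q : ℤ) ∣ E₀.Δ → q ∈ L)
    (hΔF : ∀ q : ℕ, q.Prime → (q : ℤ) ∣ F₀.Δ → q ∈ L)
    (hplaces : ∀ w : HeightOneSpectrum (𝓞 ℚ), (primesEquiv w : ℕ) ∈ L → (primesEquiv w : ℕ) ≠ 3 →
      (primesEquiv w : ℕ) ≠ ℓ →
      (((3 : ℕ) : 𝓞 ℚ) ∉ w.asIdeal ∧ Nat.card (nsmulAddMonoidHom 3 :
          (W'.baseChange (w.adicCompletion ℚ)).toAffine.Point →+ _).ker = 1) ∨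
      (W.HasSplitMultiplicativeReductionAt w ∧ W'.HasSplitMultiplicativeReductionAt w ∧
        Nat.card (nsmulAddMonoidHom 3 :
          (W.baseChange (w.adicCompletion ℚ)).toAffine.Point →+ _).ker ≤ 3) ∨
      (W.HasMultiplicativeReductionAt w ∧ W'.HasMultiplicativeReductionAt w ∧
        (∃ r : w.adicCompletion ℚ, algebraMap ℚ (w.adicCompletion ℚ) (-(W.c₄ / W.c₆)) =
          r ^ 2 * algebraMap ℚ (w.adicCompletion ℚ) (-(W'.c₄ / W'.c₆))) ∧
        (∀ ζ : w.adicCompletion ℚ, ζ ^ 3 = 1 → ζ = 1)) ∨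
      (W.HasMultiplicativeReductionAt w ∧
        ¬ IsSquare (algebraMap ℚ (w.adicCompletion ℚ) (-(W.c₄ / W.c₆))) ∧
        W'.HasGoodReductionAt w ∧ ((3 : ℕ) : 𝓞 ℚ) ∉ w.asIdeal) ∨
      (W.HasGoodReductionAt w ∧ W'.HasMultiplicativeReductionAt w ∧
        ¬ IsSquare (algebraMap ℚ (w.adicCompletion ℚ) (-(W'.c₄ / W'.c₆))) ∧
        ((3 : ℕ) : 𝓞 ℚ) ∉ w.asIdeal) ∨
      (1 < w.valuation ℚ W.j ∧ 1 < w.valuation ℚ W'.j ∧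
        (∃ r : w.adicCompletion ℚ, algebraMap ℚ (w.adicCompletion ℚ) (-(W.c₄ / W.c₆)) =
          r ^ 2 * algebraMap ℚ (w.adicCompletion ℚ) (-(W'.c₄ / W'.c₆))) ∧
        (∀ ζ : w.adicCompletion ℚ, ζ ^ 3 = 1 → ζ = 1)) ∨
      (W.HasAdditiveReductionAt w ∧ W'.HasAdditiveReductionAt w ∧ ((3 : ℕ) : 𝓞 ℚ) ∉ w.asIdeal ∧
        Nat.card (nsmulAddMonoidHom 3 :
          (W'.baseChange (w.adicCompletion ℚ)).toAffine.Point →+ _).ker = 3)) :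
    haveI : Fact (Nat.Prime 3) := ⟨Nat.prime_three⟩
    BSDp W 3 := by
  haveI : Fact (Nat.Prime 3) := ⟨Nat.prime_three⟩
  obtain ⟨S, hS⟩ := exists_placeFinset_of_primeList L
  obtain ⟨T, hTS, hT, hT3⟩ :=
    exists_paidPlaces_three_and W' L h3L ℓ hℓ hℓL hℓ3 hS htors₃ htorsℓ hbudget hrank
  exact X4RankZero.bsdp_three_of_congr_of_places₇_of_kato hKato hCT hGZK hmod W hr hX hpot hsurj htam D
    hc hq hv hU hU2 W' θ hθ S T hTS
    (good_and_not_mem_of_not_mem_placeFinset hE hF L Nat.prime_three h3L hΔE hΔF hS) hT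
    (fun w hw hwT ↦ hplaces w ((hS w).mp hw) (hT3 w hw hwT).1 (hT3 w hw hwT).2)

/-- **Record socket, potentially GOOD rows, SHARP Kato + Cassels–Tate parity, Tamagawa DEFECT `≤ 1`,
`ord₃ #Ш_an ≤ 2` and EVEN, TWO paid places: `3` and one tame prime `ℓ ≠ 3`** (FILE 2's
`…_of_katoSharp_of_tamDefect_le_one_of_primeList_paidThree` with a second paid place — the rank-3
`d1→T` rows of the D44 road with a `3` among the `c_ℓ`, `ℓ ≠ 3`: `260388a1 ← 183236a1` and
`284445bc1 ← 200165a1`, both paid at `19`). [cite: CremonaMazur2000, §3 and Table 1]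
[cite: AgasheStein2002, Thm. 3.1] [cite: Kato2004Asterisque, Thm. 14.5 (3) (p. 236), Prop. 14.16 (2) (p. 244)]
[cite: SilvermanAEC2009, Thm. X.4.14] -/
theorem X4RankZero.bsdp_three_of_congr_of_places₇_of_katoSharp_of_tamDefect_le_one_of_primeList_paidThreeAndAt
    (hKatoS : Kato2004.rankZero_padicValNat_sha_le_sub_localTamagawa_of_additive_potGood_of_imageContainsSL2)
    (hCT : exists_casselsTate_pairing (K := ℚ))
    (hGZK : rank_eq_analyticRank_of_analyticRank_le_one) (hmod : hasEntireLFunction_rat)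
    (hU : Silverman1994_thmV53_tateUniformisation.{0})
    (hU2 : Silverman1994_thmV53_corV54_tateUniformisation.{0})
    (W : WeierstrassCurve ℚ) [W.IsElliptic] [W.IsGloballyMinimal]
    (hr : W.analyticRank = 0) (hX : haveI : Fact (Nat.Prime 3) := ⟨Nat.prime_three⟩; ClassX4 W 3)
    (hpot : 0 ≤ padicValRat 3 W.j)
    (hsurj : ∀ n : ℕ, W.HasSurjectiveModNGaloisRep (3 ^ n : ℕ))
    (htam : haveI : Fact (Nat.Prime 3) := ⟨Nat.prime_three⟩
      padicValNat 3 W.tamagawaProduct ≤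
        padicValNat 3 ((W.baseChange ℚ_[3]).localTamagawaNumber ℤ_[3]) + 1)
    {N : ℕ} [NeZero N] (D : ModularParametrizationData W N) (hc : ¬ (3 : ℤ) ∣ D.maninConstant)
    {q : ℚ} (hq : shaAn W = (q : ℂ)) (hv : padicValRat 3 q ≤ 2) (hev : Even (padicValRat 3 q))
    (W' : WeierstrassCurve ℚ) [W'.IsElliptic]
    (θ : geomTorsion W' ((3 : ℕ) : ℤ) ≃+ geomTorsion W ((3 : ℕ) : ℤ))
    (hθ : ∀ (σ : Field.absoluteGaloisGroup ℚ) (P : geomTorsion W' ((3 : ℕ) : ℤ)),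
      θ (σ • P) = σ • θ P)
    (ℓ : ℕ) (hℓ : ℓ.Prime) (hℓ3 : ℓ ≠ 3)
    {t u k : ℕ} (htors₃ : ∀ w : HeightOneSpectrum (𝓞 ℚ), (primesEquiv w : ℕ) = 3 →
      Nat.card (nsmulAddMonoidHom 3 :
        (W'.baseChange (w.adicCompletion ℚ)).toAffine.Point →+ _).ker ≤ t)
    (htorsℓ : ∀ w : HeightOneSpectrum (𝓞 ℚ), (primesEquiv w : ℕ) = ℓ →
      Nat.card (nsmulAddMonoidHom 3 :
        (W'.baseChange (w.adicCompletion ℚ)).toAffine.Point →+ _).ker ≤ u)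
    (hbudget : 3 * t * u < 3 ^ k) (hrank : k ≤ W'.mordellWeilRank)
    {E₀ F₀ : WeierstrassCurve ℤ} (hE : E₀.map (Int.castRingHom ℚ) = W)
    (hF : F₀.map (Int.castRingHom ℚ) = W') (L : List ℕ) (h3L : 3 ∈ L) (hℓL : ℓ ∈ L)
    (hΔE : ∀ q : ℕ, q.Prime → (q : ℤ) ∣ E₀.Δ → q ∈ L)
    (hΔF : ∀ q : ℕ, q.Prime → (q : ℤ) ∣ F₀.Δ → q ∈ L)
    (hplaces : ∀ w : HeightOneSpectrum (𝓞 ℚ), (primesEquiv w : ℕ) ∈ L → (primesEquiv w : ℕ) ≠ 3 →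
      (primesEquiv w : ℕ) ≠ ℓ →
      (((3 : ℕ) : 𝓞 ℚ) ∉ w.asIdeal ∧ Nat.card (nsmulAddMonoidHom 3 :
          (W'.baseChange (w.adicCompletion ℚ)).toAffine.Point →+ _).ker = 1) ∨
      (W.HasSplitMultiplicativeReductionAt w ∧ W'.HasSplitMultiplicativeReductionAt w ∧
        Nat.card (nsmulAddMonoidHom 3 :
          (W.baseChange (w.adicCompletion ℚ)).toAffine.Point →+ _).ker ≤ 3) ∨
      (W.HasMultiplicativeReductionAt w ∧ W'.HasMultiplicativeReductionAt w ∧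
        (∃ r : w.adicCompletion ℚ, algebraMap ℚ (w.adicCompletion ℚ) (-(W.c₄ / W.c₆)) =
          r ^ 2 * algebraMap ℚ (w.adicCompletion ℚ) (-(W'.c₄ / W'.c₆))) ∧
        (∀ ζ : w.adicCompletion ℚ, ζ ^ 3 = 1 → ζ = 1)) ∨
      (W.HasMultiplicativeReductionAt w ∧
        ¬ IsSquare (algebraMap ℚ (w.adicCompletion ℚ) (-(W.c₄ / W.c₆))) ∧
        W'.HasGoodReductionAt w ∧ ((3 : ℕ) : 𝓞 ℚ) ∉ w.asIdeal) ∨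
      (W.HasGoodReductionAt w ∧ W'.HasMultiplicativeReductionAt w ∧
        ¬ IsSquare (algebraMap ℚ (w.adicCompletion ℚ) (-(W'.c₄ / W'.c₆))) ∧
        ((3 : ℕ) : 𝓞 ℚ) ∉ w.asIdeal) ∨
      (1 < w.valuation ℚ W.j ∧ 1 < w.valuation ℚ W'.j ∧
        (∃ r : w.adicCompletion ℚ, algebraMap ℚ (w.adicCompletion ℚ) (-(W.c₄ / W.c₆)) =
          r ^ 2 * algebraMap ℚ (w.adicCompletion ℚ) (-(W'.c₄ / W'.c₆))) ∧
        (∀ ζ : w.adicCompletion ℚ, ζ ^ 3 = 1 → ζ = 1)) ∨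
      (W.HasAdditiveReductionAt w ∧ W'.HasAdditiveReductionAt w ∧ ((3 : ℕ) : 𝓞 ℚ) ∉ w.asIdeal ∧
        Nat.card (nsmulAddMonoidHom 3 :
          (W'.baseChange (w.adicCompletion ℚ)).toAffine.Point →+ _).ker = 3)) :
    haveI : Fact (Nat.Prime 3) := ⟨Nat.prime_three⟩
    BSDp W 3 := by
  haveI : Fact (Nat.Prime 3) := ⟨Nat.prime_three⟩
  obtain ⟨S, hS⟩ := exists_placeFinset_of_primeList L
  obtain ⟨T, hTS, hT, hT3⟩ :=
    exists_paidPlaces_three_and W' L h3L ℓ hℓ hℓL hℓ3 hS htors₃ htorsℓ hbudget hrank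
  exact X4RankZero.bsdp_three_of_congr_of_places₇_of_katoSharp_of_tamDefect_le_one hKatoS hCT hGZK hmod W
    hr hX hpot hsurj htam D hc hq hv hev hU hU2 W' θ hθ S T hTS
    (good_and_not_mem_of_not_mem_placeFinset hE hF L Nat.prime_three h3L hΔE hΔF hS) hT
    (fun w hw hwT ↦ hplaces w ((hS w).mp hw) (hT3 w hw hwT).1 (hT3 w hw hwT).2)


end Summit.BirchSwinnertonDyer.Rank1Residual.Additive

end
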